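import Mathlib
import Summits.AtomisticToContinuum.HydrodynamicLimit.Theses.InformationPercolationEngine
import Summits.AtomisticToContinuum.HydrodynamicLimit.Theorems.InformationPercolationEngineKickFairRelEquilibriumMesoDefs

/-!
# Sketch for the crux idea `backward-tilt-self-averaging` (crux stmt-AtomisticToContinuum-15177,
`InformationPercolationEngine.KickFairRelEquilibriumMeso`; crux-ideate round 2, ideator 6)

Typed objects and the first lemma of the line. Nothing here is a registered stub (no skeleton at the
idea stage); every `def … : Prop` is a predicate, never asserted.

* §1 `condCov_tilt_le` — the ABSTRACT first lemma (conditional Cauchy–Schwarz for a tilt): for a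
  probability `μ`, nested σ-algebras `mP ≤ mQ`, a weight `W ≥ 0` and a bounded `mQ`-measurable `g`,
  `|μ[W g | mP] − μ[W | mP] μ[g | mP]| ≤ C √(μ[(μ[W|mQ])² | mP] − (μ[W|mP])²)` a.e. Read with
  `μ = G` (invariant law), `W = dLG/dG`, `mP = σ(P_{i,n})` (typed past), `mQ = mP ⊔ σ(X_{i,n})`
  (past + kick): the left side is `μ[W|mP] · (E_{LG}[g | P] − κ)`, so the crux's per-kick BIAS is at
  most `C √(Ov − 1)` with `Ov = G[F² | P]/G[W | P]²`, `F = G[W | P ⊔ X]` — the EXPONENTIAL REPLICA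
  OVERLAP of the backward-transported time-zero tilt (two `G`-replicas sharing the mesoscopic past and
  the impact vector). No weight `h` appears: the sup over past-measurable weights is gone.
* §2 the crux-level objects over the landed vocabulary
  (`…Theorems.KickFairRelEquilibriumMesoLine`: `past`, `kick`, `kappa`, `cnt`, `Flow`, `Phase`):
  `tiltW` (= `dLG/dG` as `rnDeriv`), `pastSigma`, `kickSigma`, `fwdWeight`, `overlapExcess`,
  `biasLG`, and the predicates `OverlapDecay cs` (the card's C⁺, h-free), `BiasHalf cs`,
  `LGFluctHalf cs`, `MeanCount`.
* §3 the composition targets of the future line, as commented signatures only.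
-/

noncomputable section

open MeasureTheory Set Filter Topology
open scoped ENNReal Classical

namespace Summit.AtomisticToContinuum.HydrodynamicLimit.Cruxes.KickFairRelEquilibriumMeso.BackwardTilt

/-! ## §1 The abstract first lemma: conditional Cauchy–Schwarz for a tilt -/

/-- **Conditional covariance bound for a tilted conditional expectation.** For a probability measure
`μ`, σ-algebras `mP ≤ mQ ≤ m0`, a nonnegative integrable weight `W` whose `mQ`-conditional
expectation is square integrable, and a bounded `mQ`-strongly-measurable `g`:
`|μ[W·g | mP] − μ[W | mP]·μ[g | mP]| ≤ C·√(μ[(μ[W | mQ])² | mP] − (μ[W | mP])²)` almost everywhere.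
(Tower: `μ[W g|mP] = μ[F g|mP]` with `F = μ[W|mQ]`; then conditional Cauchy–Schwarz on
`CondCov_{mP}(F, g)` and `CondVar_{mP}(g) ≤ C²`.) With `μ = G`, `W = dLG/dG`, `mP = σ(past)`,
`mQ = σ(past) ⊔ σ(kick)` this bounds the crux's per-kick bias `E_{LG}[g|P] − κ` by
`C·√(overlap − 1)`, uniformly in NOTHING ELSE (no weight `h`). [folklore] -/
theorem condCov_tilt_le {Ω : Type*} {m0 : MeasurableSpace Ω} (μ : Measure Ω) [IsProbabilityMeasure μ]
    (mP mQ : MeasurableSpace Ω) (hPQ : mP ≤ mQ) (hQ : mQ ≤ m0)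
    (W g : Ω → ℝ) (hW : 0 ≤ᵐ[μ] W) (hWi : Integrable W μ)
    (hF2 : MemLp (MeasureTheory.condExp mQ μ W) 2 μ)
    (C : ℝ) (hC : 0 ≤ C) (hg : ∀ x, |g x| ≤ C) (hgm : StronglyMeasurable[mQ] g) :
    ∀ᵐ x ∂μ,
      |(MeasureTheory.condExp mP μ (fun y => W y * g y)) x
          - (MeasureTheory.condExp mP μ W) x * (MeasureTheory.condExp mP μ g) x|
        ≤ C * Real.sqrt ((MeasureTheory.condExp mP μ (fun y => (MeasureTheory.condExp mQ μ W) y ^ 2)) x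
              - ((MeasureTheory.condExp mP μ W) x) ^ 2) := by
  sorry

/-! ## §2 The crux-level objects -/

open Literature.Analysis.FluidPDE Literature.MathematicalPhysics.KineticTheory
open Summit.AtomisticToContinuum.HydrodynamicLimit.Theorems.KickFairRelEquilibriumMesoLine
  (Past Phase Flow cnt past kick kappa)

/-- The invariant (global Gibbs) law `G_{θ₁} = localGibbsLaw σ 1 0 θ₁` at reference temperature `θ₁`.
The crux's `κ` is computed at `θ₁ = 1`; the overlap objects below are taken at `θ₁ = 2 sup θ₀` so that
`dLG/dG_{θ₁}` has all moments (for `θ₁ ≤ sup θ₀ / 2` already the second moment is infinite and a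
`condExp` of `F²` would be Mathlib junk `0`). Conditionally on the typed past — which contains the exact
velocities of all spheres, hence the conserved kinetic energy — the laws `G_{θ}(· | σ(P))` do not depend
on `θ` (the density `dG_θ/dG_1 ∝ exp(-(θ⁻¹-1)·KE/2)` is `σ(P)`-measurable), so `κ` is the same under
every `G_θ` (velocity-channel exactness, p127858 class). -/
def Geq (σ θ₁ : ℝ) (N : ℕ) (Φ : Flow σ N) : Measure (Phase N) :=
  localGibbsLaw σ (fun _ => 1) (fun _ => 0) (fun _ => θ₁) N Φ

/-- The local Gibbs law `LG` of the profiles. -/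
def LGof (σ : ℝ) (a₀ θ₀ : T3 → ℝ) (u₀ : T3 → V3) (N : ℕ) (Φ : Flow σ N) : Measure (Phase N) :=
  localGibbsLaw σ a₀ u₀ θ₀ N Φ

/-- The **time-zero tilt** `W = dLG/dG` as a Radon–Nikodym derivative on phase space (the flow is a
deterministic function of the phase point, so this single density carries ALL non-equilibrium
information to every time). -/
def tiltW (σ θ₁ : ℝ) (a₀ θ₀ : T3 → ℝ) (u₀ : T3 → V3) (N : ℕ) (Φ : Flow σ N) : Phase N → ℝ :=
  fun z => ((LGof σ a₀ θ₀ u₀ N Φ).rnDeriv (Geq σ θ₁ N Φ) z).toReal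

/-- The σ-algebra of the crux's typed past `P_{i,n}` at mesh `r` (the comap σ-algebra `κ` uses). -/
@[reducible] def pastSigma {σ : ℝ} {N : ℕ} (Φ : Flow σ N) (r : ℝ) (i : Fin (N + 1)) (n : ℕ) :
    MeasurableSpace (Phase N) :=
  MeasurableSpace.comap (fun z => past Φ r z i n) inferInstance

/-- Past ⊔ kick: the σ-algebra generated by `P_{i,n}` and the kick datum `X_{i,n} = (ω, v⁻, v*⁻)`. -/
@[reducible] def kickSigma {σ : ℝ} {N : ℕ} (Φ : Flow σ N) (r : ℝ) (i : Fin (N + 1)) (n : ℕ) :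
    MeasurableSpace (Phase N) :=
  pastSigma Φ r i n ⊔ MeasurableSpace.comap (fun z => kick Φ i n z) inferInstance

/-- The **forward weight** `F_{i,n} = G[W | P_{i,n} ⊔ X_{i,n}]`: the backward-transported tilt seen
through the past and the kick only (the "conditional partition function" whose flatness in the
impact vector is kick fairness). -/
def fwdWeight {σ : ℝ} {N : ℕ} (Φ : Flow σ N) (r θ₁ : ℝ) (a₀ θ₀ : T3 → ℝ) (u₀ : T3 → V3)
    (i : Fin (N + 1)) (n : ℕ) : Phase N → ℝ :=
  MeasureTheory.condExp (kickSigma Φ r i n) (Geq σ θ₁ N Φ) (tiltW σ θ₁ a₀ θ₀ u₀ N Φ)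

/-- The past-level weight `F̄_{i,n} = G[W | P_{i,n}]` (density of `LG` w.r.t. `G` on `σ(P_{i,n})`). -/
def pastWeight {σ : ℝ} {N : ℕ} (Φ : Flow σ N) (r θ₁ : ℝ) (a₀ θ₀ : T3 → ℝ) (u₀ : T3 → V3)
    (i : Fin (N + 1)) (n : ℕ) : Phase N → ℝ :=
  MeasureTheory.condExp (pastSigma Φ r i n) (Geq σ θ₁ N Φ) (tiltW σ θ₁ a₀ θ₀ u₀ N Φ)

/-- The **overlap excess** `G[F² | P] − F̄²` (un-normalised replica overlap minus one: two
`G`-replicas sharing `P_{i,n}`; the excess of `E[W W']` when they also share the kick over when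
they do not). The card's mechanism: this is small because the backward tilt SELF-AVERAGES over the
sub-cell degrees of freedom the mesoscopic past leaves free. -/
def overlapExcess {σ : ℝ} {N : ℕ} (Φ : Flow σ N) (r θ₁ : ℝ) (a₀ θ₀ : T3 → ℝ) (u₀ : T3 → V3)
    (i : Fin (N + 1)) (n : ℕ) : Phase N → ℝ :=
  fun z => MeasureTheory.condExp (pastSigma Φ r i n) (Geq σ θ₁ N Φ)
      (fun y => fwdWeight Φ r θ₁ a₀ θ₀ u₀ i n y ^ 2) z - pastWeight Φ r θ₁ a₀ θ₀ u₀ i n z ^ 2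

/-- The **per-kick non-equilibrium bias** `β_{i,n} = E_{LG}[g(X_{i,n}) | σ(P_{i,n})] − κ_{i,n}`
(the crux's `κ` verbatim from the landed vocabulary). `sup_h E_{LG} S_h` is, up to the fluctuation
half, `(ε/(N+1)) E_{LG} Σ |β|`. -/
def biasLG {σ : ℝ} {N : ℕ} (Φ : Flow σ N) (r : ℝ) (a₀ θ₀ : T3 → ℝ) (u₀ : T3 → V3)
    (g : V3 × V3 × V3 → ℝ) (i : Fin (N + 1)) (n : ℕ) : Phase N → ℝ :=
  fun z => MeasureTheory.condExp (pastSigma Φ r i n) (LGof σ a₀ θ₀ u₀ N Φ) (fun y => g (kick Φ i n y)) z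
    - kappa Φ r g i n z

/-- **C⁺ of the card — OVERLAP DECAY along the cell sequence `cs` (h-free, g-free):** for continuous
positive profiles `∃ σ₀ ∀ σ < σ₀ ∀ Φ ∀ τ ∀ δ ∃ N₀ ∀ N ≥ N₀`,
`E_{LG}[(ε/(N+1)) Σ_i Σ_{n < cnt_i} min 1 (√(overlapExcess)/F̄)] ≤ δ` at reference temperature
`θ₁ = 2 sup θ₀` (all moments of `dLG/dG_{θ₁}` finite, so no `condExp` junk; `κ` is unchanged, see
`Geq`): the relative replica overlap of the backward tilt is `1 + o(1)` on average over the collisions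
`LG` realises. -/
def OverlapDecay (cs : ℕ → ℝ) : Prop :=
  ∀ (a₀ θ₀ : T3 → ℝ) (u₀ : T3 → V3), Continuous a₀ → Continuous θ₀ → Continuous u₀ →
    (∀ x, 0 < a₀ x) → (∀ x, 0 < θ₀ x) → ∃ σ₀ : ℝ, 0 < σ₀ ∧ ∀ σ : ℝ, 0 < σ → σ < σ₀ →
    ∀ Φ : (N : ℕ) → Flow σ N, ∀ τ : ℝ, 0 < τ → ∀ δ : ℝ, 0 < δ → ∃ N₀ : ℕ, ∀ N : ℕ, N₀ ≤ N →
    let θ₁ : ℝ := 2 * ⨆ x, θ₀ x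
    ∫⁻ z, ENNReal.ofReal (hsDiameter σ N / ((N : ℝ) + 1) *
        ∑ i : Fin (N + 1), ∑ n ∈ Finset.range (cnt (Φ N) τ z i),
          min 1 (Real.sqrt (overlapExcess (Φ N) (cs N) θ₁ a₀ θ₀ u₀ i n z) /
            pastWeight (Φ N) (cs N) θ₁ a₀ θ₀ u₀ i n z))
      ∂(LGof σ a₀ θ₀ u₀ N (Φ N)) ≤ ENNReal.ofReal δ

/-- **The bias half of the crux along `cs`:** `(ε/(N+1)) E_{LG} Σ_i Σ_{n<cnt_i} |β_{i,n}| → 0` for every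
bounded continuous kick test `g` (what `sup_h` of the crux's MEAN reduces to). -/
def BiasHalf (cs : ℕ → ℝ) : Prop :=
  ∀ (a₀ θ₀ : T3 → ℝ) (u₀ : T3 → V3), Continuous a₀ → Continuous θ₀ → Continuous u₀ →
    (∀ x, 0 < a₀ x) → (∀ x, 0 < θ₀ x) → ∃ σ₀ : ℝ, 0 < σ₀ ∧ ∀ σ : ℝ, 0 < σ → σ < σ₀ →
    ∀ Φ : (N : ℕ) → Flow σ N, ∀ τ : ℝ, 0 < τ →
    ∀ g : V3 × V3 × V3 → ℝ, Continuous g → (∃ C : ℝ, ∀ p, |g p| ≤ C) →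
    ∀ δ : ℝ, 0 < δ → ∃ N₀ : ℕ, ∀ N : ℕ, N₀ ≤ N →
    ∫⁻ z, ENNReal.ofReal (hsDiameter σ N / ((N : ℝ) + 1) *
        ∑ i : Fin (N + 1), ∑ n ∈ Finset.range (cnt (Φ N) τ z i), |biasLG (Φ N) (cs N) a₀ θ₀ u₀ g i n z|)
      ∂(LGof σ a₀ θ₀ u₀ N (Φ N)) ≤ ENNReal.ofReal δ

/-- **The LG-fluctuation half along `cs`:** the kick sum compensated by its OWN-law conditional means
`E_{LG}[g | P_{i,n}]` (a sum of `LG`-conditionally centred terms) is small in `L¹(LG)` uniformly over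
past-measurable weights `|h| ≤ 1`. (Each term has mean zero under `LG`; this is a concentration
statement, not a disguised mean statement.) -/
def LGFluctHalf (cs : ℕ → ℝ) : Prop :=
  ∀ (a₀ θ₀ : T3 → ℝ) (u₀ : T3 → V3), Continuous a₀ → Continuous θ₀ → Continuous u₀ →
    (∀ x, 0 < a₀ x) → (∀ x, 0 < θ₀ x) → ∃ σ₀ : ℝ, 0 < σ₀ ∧ ∀ σ : ℝ, 0 < σ → σ < σ₀ →
    ∀ Φ : (N : ℕ) → Flow σ N, ∀ τ : ℝ, 0 < τ →
    ∀ g : V3 × V3 × V3 → ℝ, Continuous g → (∃ C : ℝ, ∀ p, |g p| ≤ C) →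
    ∀ δ : ℝ, 0 < δ → ∃ N₀ : ℕ, ∀ N : ℕ, N₀ ≤ N →
    ∀ h : Fin (N + 1) → ℕ → Past N → ℝ, (∀ i n, Measurable (h i n)) → (∀ i n p, |h i n p| ≤ 1) →
    ∫⁻ z, ENNReal.ofReal |hsDiameter σ N / ((N : ℝ) + 1) *
        ∑ i : Fin (N + 1), ∑ n ∈ Finset.range (cnt (Φ N) τ z i),
          h i n (past (Φ N) (cs N) z i n) *
            (g (kick (Φ N) i n z) -
              MeasureTheory.condExp (pastSigma (Φ N) (cs N) i n) (LGof σ a₀ θ₀ u₀ N (Φ N))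
                (fun y => g (kick (Φ N) i n y)) z)|
      ∂(LGof σ a₀ θ₀ u₀ N (Φ N)) ≤ ENNReal.ofReal δ

/-- **MeanCount — the LG-native a-priori input every line of this crux carries** (mean form; U-class,
stmt-15144 class): the normalised collision count `(ε/(N+1)) Σ_i cnt_i(τ)` has `LG`-expectation
bounded uniformly in `N` (eventually). -/
def MeanCount : Prop :=
  ∀ (a₀ θ₀ : T3 → ℝ) (u₀ : T3 → V3), Continuous a₀ → Continuous θ₀ → Continuous u₀ →
    (∀ x, 0 < a₀ x) → (∀ x, 0 < θ₀ x) → ∃ σ₀ : ℝ, 0 < σ₀ ∧ ∀ σ : ℝ, 0 < σ → σ < σ₀ →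
    ∀ Φ : (N : ℕ) → Flow σ N, ∀ τ : ℝ, 0 < τ → ∃ K : ℝ, ∃ N₀ : ℕ, ∀ N : ℕ, N₀ ≤ N →
    ∫⁻ z, ENNReal.ofReal (hsDiameter σ N / ((N : ℝ) + 1) * ∑ i : Fin (N + 1), (cnt (Φ N) τ z i : ℝ))
      ∂(LGof σ a₀ θ₀ u₀ N (Φ N)) ≤ ENNReal.ofReal K

/-! ## §3 Composition targets of the future line (signatures recorded as comments; NOT stubs)

* `biasHalf_of_overlapDecay : OverlapDecay cs → BiasHalf cs` — `condCov_tilt_le` with `μ = G_{θ₁}`,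
  `W = tiltW`, `LG = W • G_{θ₁}` (rnDeriv of equivalent laws) and `κ` unchanged under `G_{θ₁}`; pointwise
  `|β| ≤ 2C · min 1 √(Ov − 1)` (since also `|β| ≤ 2C`), summed with the crux's own weights — NO count
  input is needed for the bias half.
* `crux_of_halves : (admissible cs) → BiasHalf cs → LGFluctHalf cs →
    Summit.AtomisticToContinuum.HydrodynamicLimit.Theses.InformationPercolationEngine.KickFairRelEquilibriumMeso`
  — triangle inequality: `g − κ = (g − E_{LG}[g|P]) + β`, `|h| ≤ 1`.
-/

/-- Sanity (window algebra, landed as `quarter_admissible` in `Disproof.lean` for `(N+1)^{-1/4}`): the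
σ-free LOWER-EDGE sequence the card recommends, `cs N = (N+1)^{-1/3} · log (N+2)`, has
`(N+1) · cs³ = (log(N+2))³ → ∞`. -/
theorem lowerEdge_log_cube :
    Tendsto (fun N : ℕ => ((N : ℝ) + 1) * (((N : ℝ) + 1) ^ (-(1 / 3 : ℝ)) * Real.log ((N : ℝ) + 2)) ^ 3)
      atTop atTop := by
  have key : ∀ N : ℕ, ((N : ℝ) + 1) * (((N : ℝ) + 1) ^ (-(1 / 3 : ℝ)) * Real.log ((N : ℝ) + 2)) ^ 3
      = (Real.log ((N : ℝ) + 2)) ^ 3 := by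
    intro N
    have hN : (0 : ℝ) < (N : ℝ) + 1 := by positivity
    rw [mul_pow, ← Real.rpow_natCast (((N : ℝ) + 1) ^ (-(1 / 3 : ℝ))) 3, ← Real.rpow_mul hN.le]
    norm_num
    rw [← mul_assoc, show ((N : ℝ) + 1) * ((N : ℝ) + 1) ^ (-1 : ℝ) = 1 by
      rw [Real.rpow_neg_one, mul_inv_cancel₀ hN.ne'], one_mul]
  simp_rw [key]
  refine (tendsto_pow_atTop (by norm_num : (3 : ℕ) ≠ 0)).comp ?_
  exact Real.tendsto_log_atTop.comp
    (tendsto_atTop_add_const_right _ 2 tendsto_natCast_atTop_atTop)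

end Summit.AtomisticToContinuum.HydrodynamicLimit.Cruxes.KickFairRelEquilibriumMeso.BackwardTilt
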